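import Literature.MathematicalPhysics.QuantumFieldTheory.Balaban1983to89.T4BetaStationary
import Summits.QuantumFields.BalabanUV.T4Continuum.Spine.NE4.FadingFromRateRelAnalytic

/-!
# Spine/NE4/OneSidedNoGo — the ONE-SIDED ∕ MONOTONE-IN-THE-CUTOFF weakenings of NE4 at node U2: what they give (the continuum
# β-functional EXISTS along every infrared history, with bounded variation) and what they cannot give (any two-sided rate — even
# together with node U2's minimal regularity shape `LocalAnalyticRel` and the uniform bound)

Cell `pub-balaban-gaps` (YM blitz G2), seat `ne4`, generation 8 (unit `pub-balaban-gaps-ne4-g8`); record `HOME/ne/NE4.md` §5 (R41).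
NE4 = `T4CouplingMatching.ScaleShiftRate c θ γ β` is TWO-SIDED: `|β_{k+2}(w) − β_{k+1}(tail w)| ≤ cθ^k` on the boxes.  The eighth reader's
variant family: keep only the UPPER half `β_{k+2}(w) − β_{k+1}(tail w) ≤ cθ^k` (`ScaleShiftUpper`; the case `c = 0` is a scheme whose
β-functions are MONOTONE in the cutoff at infrared-matched couplings, `MonotoneAlongScales`), plus the printed-type uniform bound.
 * §1 shapes and the trivial bookkeeping (`ScaleShiftRate ⟺ upper ∧ lower`; monotone = upper with `c = 0`).
 * §2 WHAT ONE-SIDEDNESS GIVES (kernel): along every box-valued reversed history `h` (`T4BetaStationary.revHist`) the β-values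
   `k ↦ β k (revHist h k)` have TOTAL VARIATION `≤ 2B + 2c∕(1−θ)` (`variation_le_of_upper`) and CONVERGE (`tendsto_betaInf_of_upper`): the continuum
   β-functional `T4BetaStationary.betaInf β h` of census (R17) EXISTS under one-sided control — with NO rate and NO uniformity in `h`.
 * §3 WHAT IT CANNOT GIVE (kernel witness `expFamily B`: `β_{k+1}(g_0,…,g_k) = B·exp(−k·g_k)`): monotone along the scales (`c = 0`), values in
   `]0, B]`, relative real-analytic charts `LocalAnalyticRel B γ ρ` for EVERY `ρ ≤ 1` (node U2's minimal regularity shape, census (R40)) — and yet its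
   two-sided scale shift has a HARMONIC envelope: at scale `k ≥ 1∕γ` the constant history `g ≡ 1∕k` gives `|β_{k+2} − β_{k+1}| ≥ B∕(2e·k)`
   (`harmonic_lower_expFamily`), so `ScaleShiftRate c θ γ (expFamily B)` FAILS for every `c` and every `0 ≤ θ < 1` (`not_scaleShiftRate_expFamily`).
   Hence neither one-sided control nor monotone cutoff-dependence can replace NE4 in node U2's input list (whose output FORCES two-sided NE4
   along the runs, `Spine/NE4/Necessity`); Dini's theorem would upgrade monotone + continuous to UNIFORM convergence on compact coupling boxes,
   never to a rate (remark, not typed).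
No printed statement supplies even the sign of `β_{k+2}(w) − β_{k+1}(tail w)` ([Balaban1987RG1] p. 264: η-uniform statements only; GAPS G-t4-U2-1).

HONEST FRAMING: hypothesis shapes + a toy family + elementary real analysis; nothing of Bałaban's asserted beyond print; NE4 NOT IN PRINT, NOT
PROVED (DEPENDENT); spine PROVED 0∕9 unchanged; one finite T⁴ — NOT continuum on ℝ⁴, NOT infinite volume, NOT a mass gap, NOT Clay.
Reference (TYPES only): [Balaban1987RG1] = T. Bałaban, CMP **109** (1987) 249–301, (0.20) p. 256, §1 p. 264.
-/

noncomputable section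

namespace Summit.QuantumFields.BalabanUV.T4Continuum.Spine.NE4

open Set Filter Topology Metric
open Literature.MathematicalPhysics.QuantumFieldTheory.Balaban1983to89
open Literature.MathematicalPhysics.QuantumFieldTheory.Balaban1983to89.FlowStep
open Literature.MathematicalPhysics.QuantumFieldTheory.Balaban1983to89.T4CouplingMatching
open Literature.MathematicalPhysics.QuantumFieldTheory.Balaban1983to89.T4BetaStationary

/-! ## §1 The one-sided shapes -/

/-- [shape] HYPOTHESIS SHAPE — **ONE-SIDED NE4 (upper)**: `β_{k+2}(w) − β_{k+1}(tail w) ≤ cθ^k` on the boxes; `c = 0` = the β-functions are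
MONOTONE (non-increasing) in the cutoff at infrared-matched couplings.  NOT PRINTED (no sign information on the η-dependence is in print);
NOT a fact. [folklore] -/
def ScaleShiftUpper (c θ γ : ℝ) (β : HBeta) : Prop :=
  ∀ k (w : Fin (k + 2) → ℝ), w ∈ Box γ (k + 1) → β (k + 1) w - β k (Fin.tail w) ≤ c * θ ^ k

/-- [shape] HYPOTHESIS SHAPE — **ONE-SIDED NE4 (lower)**: `−cθ^k ≤ β_{k+2}(w) − β_{k+1}(tail w)` on the boxes.  NOT a fact. [folklore] -/
def ScaleShiftLower (c θ γ : ℝ) (β : HBeta) : Prop :=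
  ∀ k (w : Fin (k + 2) → ℝ), w ∈ Box γ (k + 1) → -(c * θ ^ k) ≤ β (k + 1) w - β k (Fin.tail w)

/-- [shape] HYPOTHESIS SHAPE — **MONOTONE ALONG THE SCALES**: `β_{k+2}(w) ≤ β_{k+1}(tail w)` on the boxes (a scheme whose β-functions converge
monotonically in the cutoff).  NOT a fact. [folklore] -/
def MonotoneAlongScales (γ : ℝ) (β : HBeta) : Prop :=
  ∀ k (w : Fin (k + 2) → ℝ), w ∈ Box γ (k + 1) → β (k + 1) w ≤ β k (Fin.tail w)

/-- [bookkeeping] NE4 is exactly the conjunction of its two one-sided halves. [folklore] -/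
theorem scaleShiftRate_iff_upper_and_lower {c θ γ : ℝ} {β : HBeta} :
    ScaleShiftRate c θ γ β ↔ ScaleShiftUpper c θ γ β ∧ ScaleShiftLower c θ γ β := by
  constructor
  · intro h
    exact ⟨fun k w hw => (abs_le.mp (h k w hw)).2, fun k w hw => (abs_le.mp (h k w hw)).1⟩
  · rintro ⟨hu, hl⟩ k w hw
    exact abs_le.mpr ⟨hl k w hw, hu k w hw⟩

/-- [bookkeeping] Monotone along the scales = one-sided NE4 with constant `0` (at any rate `θ`). [folklore] -/
theorem monotoneAlongScales_iff_upper_zero {γ : ℝ} (θ : ℝ) {β : HBeta} :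
    MonotoneAlongScales γ β ↔ ScaleShiftUpper 0 θ γ β := by
  simp only [MonotoneAlongScales, ScaleShiftUpper, zero_mul, sub_nonpos]

/-- [bookkeeping] Monotone along the scales ⟹ one-sided NE4 with every `c ≥ 0`, `θ ≥ 0`. [folklore] -/
theorem scaleShiftUpper_of_monotone {c θ γ : ℝ} {β : HBeta} (hm : MonotoneAlongScales γ β) (hc : 0 ≤ c) (hθ : 0 ≤ θ) :
    ScaleShiftUpper c θ γ β := fun k w hw =>
  (sub_nonpos.mpr (hm k w hw)).trans (mul_nonneg hc (pow_nonneg hθ k))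

/-! ## §2 What one-sidedness gives: bounded variation and convergence along every infrared history -/

/-- [bookkeeping] One-sided NE4 read along the prefixes of ONE box-valued reversed history (`tail_revHist`):
`β (k+1) (revHist h (k+1)) − β k (revHist h k) ≤ cθ^k`. [folklore] -/
theorem upper_along_revHist {c θ γ : ℝ} {β : HBeta} (hU : ScaleShiftUpper c θ γ β) {h : ℕ → ℝ} (hh : SeqBox γ h) (k : ℕ) :
    β (k + 1) (revHist h (k + 1)) - β k (revHist h k) ≤ c * θ ^ k := by
  have := hU k (revHist h (k + 1)) (revHist_mem_box hh (k + 1))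
  rwa [tail_revHist] at this

/-- **BOUNDED VARIATION** (the positive content of one-sidedness): one-sided NE4 (`c ≥ 0`, `0 ≤ θ < 1`) and the uniform bound `|β| ≤ B` on the
boxes give, along every box-valued reversed history, `Σ_{k<K} |β (k+1) (revHist h (k+1)) − β k (revHist h k)| ≤ 2B + 2c∕(1−θ)` for every `K`
(`|x| ≤ 2(cθ^k) − x` when `x ≤ cθ^k` and `cθ^k ≥ 0`; the plain sum telescopes). [folklore] -/
theorem variation_le_of_upper {c θ γ B : ℝ} {β : HBeta} (hU : ScaleShiftUpper c θ γ β)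
    (hB : ∀ k (v : Fin (k + 1) → ℝ), v ∈ Box γ k → |β k v| ≤ B) (hc : 0 ≤ c) (hθ0 : 0 ≤ θ) (hθ1 : θ < 1)
    {h : ℕ → ℝ} (hh : SeqBox γ h) (K : ℕ) :
    ∑ k ∈ Finset.range K, |β (k + 1) (revHist h (k + 1)) - β k (revHist h k)| ≤ 2 * B + 2 * c / (1 - θ) := by
  set a : ℕ → ℝ := fun k => β k (revHist h k) with ha
  have hpt : ∀ k, |a (k + 1) - a k| ≤ 2 * (c * θ ^ k) - (a (k + 1) - a k) := by
    intro k
    have h1 : a (k + 1) - a k ≤ c * θ ^ k := upper_along_revHist hU hh k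
    have h2 : 0 ≤ c * θ ^ k := mul_nonneg hc (pow_nonneg hθ0 k)
    rcases le_or_gt 0 (a (k + 1) - a k) with h3 | h3
    · rw [abs_of_nonneg h3]; linarith
    · rw [abs_of_neg h3]; linarith
  have hsum : ∑ k ∈ Finset.range K, |a (k + 1) - a k| ≤ 2 * c * ∑ k ∈ Finset.range K, θ ^ k - (a K - a 0) := by
    calc ∑ k ∈ Finset.range K, |a (k + 1) - a k|
        ≤ ∑ k ∈ Finset.range K, (2 * (c * θ ^ k) - (a (k + 1) - a k)) := Finset.sum_le_sum fun k _ => hpt k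
      _ = 2 * c * ∑ k ∈ Finset.range K, θ ^ k - (a K - a 0) := by
          rw [Finset.sum_sub_distrib, Finset.sum_range_sub, Finset.mul_sum]
          congr 1
          exact Finset.sum_congr rfl fun k _ => by ring
  have hgeom : ∑ k ∈ Finset.range K, θ ^ k ≤ 1 / (1 - θ) := by
    rw [one_div, ← tsum_geometric_of_lt_one hθ0 hθ1]
    exact (summable_geometric_of_lt_one hθ0 hθ1).sum_le_tsum _ fun i _ => pow_nonneg hθ0 i
  have hK : |a K| ≤ B := hB K (revHist h K) (revHist_mem_box hh K)
  have h0 : |a 0| ≤ B := hB 0 (revHist h 0) (revHist_mem_box hh 0)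
  have hK' := neg_abs_le (a K)
  have h0' := le_abs_self (a 0)
  have h2c : 2 * c * ∑ k ∈ Finset.range K, θ ^ k ≤ 2 * c * (1 / (1 - θ)) := mul_le_mul_of_nonneg_left hgeom (by linarith)
  calc ∑ k ∈ Finset.range K, |a (k + 1) - a k| ≤ 2 * c * ∑ k ∈ Finset.range K, θ ^ k - (a K - a 0) := hsum
    _ ≤ 2 * c * (1 / (1 - θ)) + (B + B) := by linarith
    _ = 2 * B + 2 * c / (1 - θ) := by ring

/-- **CONVERGENCE — THE CONTINUUM β-FUNCTIONAL EXISTS UNDER ONE-SIDED CONTROL**: one-sided NE4 (`c ≥ 0`, `0 ≤ θ < 1`) and the uniform bound give,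
along every box-valued reversed history `h`, `β k (revHist h k) → T4BetaStationary.betaInf β h` (the object of census (R17), there obtained from
the two-sided NE4 WITH a geometric rate): `k ↦ β k (revHist h k) − c·Σ_{j<k} θ^j` is antitone and bounded below.  NO rate, NO uniformity in `h`.
[folklore] -/
theorem tendsto_betaInf_of_upper {c θ γ B : ℝ} {β : HBeta} (hU : ScaleShiftUpper c θ γ β)
    (hB : ∀ k (v : Fin (k + 1) → ℝ), v ∈ Box γ k → |β k v| ≤ B) (hc : 0 ≤ c) (hθ0 : 0 ≤ θ) (hθ1 : θ < 1)
    {h : ℕ → ℝ} (hh : SeqBox γ h) :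
    Tendsto (fun k => β k (revHist h k)) atTop (𝓝 (betaInf β h)) := by
  set a : ℕ → ℝ := fun k => β k (revHist h k) with ha
  set d : ℕ → ℝ := fun k => a k - c * ∑ j ∈ Finset.range k, θ ^ j with hd
  have hanti : Antitone d := by
    refine antitone_nat_of_succ_le fun k => ?_
    have h1 : a (k + 1) - a k ≤ c * θ ^ k := upper_along_revHist hU hh k
    simp only [hd, Finset.sum_range_succ, mul_add]
    linarith
  have hbdd : BddBelow (range d) := by
    refine ⟨-B - c * (1 / (1 - θ)), ?_⟩
    rintro _ ⟨k, rfl⟩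
    have h1 : -B ≤ a k := (neg_abs_le (a k)).trans' (neg_le_neg (hB k (revHist h k) (revHist_mem_box hh k)))
    have hgeom : ∑ j ∈ Finset.range k, θ ^ j ≤ 1 / (1 - θ) := by
      rw [one_div, ← tsum_geometric_of_lt_one hθ0 hθ1]
      exact (summable_geometric_of_lt_one hθ0 hθ1).sum_le_tsum _ fun i _ => pow_nonneg hθ0 i
    have h2 : c * ∑ j ∈ Finset.range k, θ ^ j ≤ c * (1 / (1 - θ)) := mul_le_mul_of_nonneg_left hgeom hc
    show -B - c * (1 / (1 - θ)) ≤ a k - c * ∑ j ∈ Finset.range k, θ ^ j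
    linarith
  have hdlim : Tendsto d atTop (𝓝 (⨅ k, d k)) := tendsto_atTop_ciInf hanti hbdd
  have hglim : Tendsto (fun k => c * ∑ j ∈ Finset.range k, θ ^ j) atTop (𝓝 (c * (1 - θ)⁻¹)) :=
    ((hasSum_geometric_of_lt_one hθ0 hθ1).tendsto_sum_nat).const_mul c
  have halim : Tendsto a atTop (𝓝 ((⨅ k, d k) + c * (1 - θ)⁻¹)) := by
    have := hdlim.add hglim
    refine this.congr fun k => ?_
    simp only [hd]; ring
  rw [betaInf, halim.limUnder_eq]
  exact halim

/-- **COROLLARY — MONOTONE SCHEMES**: monotone along the scales + the uniform bound ⟹ the continuum β-functional exists along every box-valued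
reversed history, with total variation `≤ 2B`. [folklore] -/
theorem tendsto_betaInf_of_monotone {γ B : ℝ} {β : HBeta} (hm : MonotoneAlongScales γ β)
    (hB : ∀ k (v : Fin (k + 1) → ℝ), v ∈ Box γ k → |β k v| ≤ B) {h : ℕ → ℝ} (hh : SeqBox γ h) :
    Tendsto (fun k => β k (revHist h k)) atTop (𝓝 (betaInf β h)) ∧
      ∀ K, ∑ k ∈ Finset.range K, |β (k + 1) (revHist h (k + 1)) - β k (revHist h k)| ≤ 2 * B := by
  have hU : ScaleShiftUpper 0 0 γ β := scaleShiftUpper_of_monotone hm le_rfl le_rfl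
  refine ⟨tendsto_betaInf_of_upper hU hB le_rfl le_rfl one_pos hh, fun K => ?_⟩
  have := variation_le_of_upper hU hB le_rfl le_rfl one_pos hh K
  simpa using this

/-! ## §3 What one-sidedness cannot give: the witness `expFamily` -/

/-- THE WITNESS FAMILY `β_{k+1}(g_0,…,g_k) = B·exp(−k·g_k)`: last coupling only, decreasing in the scale index at fixed coupling, at the
NON-UNIFORM rate `e^{−g}` (a cutoff artefact `η^{g∕log L}` whose exponent degenerates as `g → 0`).  A toy inhabitant of the shapes, not a model
of [Balaban1987RG1] (1.22). [folklore] -/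
def expFamily (B : ℝ) : HBeta := fun k v => B * Real.exp (-((k : ℝ) * v (Fin.last k)))

/-- The last entry survives `Fin.tail`: `Fin.tail w (Fin.last k) = w (Fin.last (k+1))`. [folklore] -/
theorem tail_last_eq {k : ℕ} (w : Fin (k + 2) → ℝ) : Fin.tail w (Fin.last k) = w (Fin.last (k + 1)) := by
  rw [Fin.tail, Fin.succ_last]

/-- THE UNIFORM BOUND: `|expFamily B k v| ≤ B` on the boxes (`B ≥ 0`; the exponent `−k·g_k` is `≤ 0`). [folklore] -/
theorem abs_expFamily_le {B γ : ℝ} (hB : 0 ≤ B) {k : ℕ} {v : Fin (k + 1) → ℝ} (hv : v ∈ Box γ k) : |expFamily B k v| ≤ B := by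
  have hg : 0 < v (Fin.last k) := ((mem_box.mp hv) (Fin.last k)).1
  have he : Real.exp (-((k : ℝ) * v (Fin.last k))) ≤ 1 :=
    Real.exp_le_one_iff.mpr (neg_nonpos.mpr (mul_nonneg (Nat.cast_nonneg k) hg.le))
  unfold expFamily
  rw [abs_mul, abs_of_nonneg hB, abs_of_pos (Real.exp_pos _)]
  exact mul_le_of_le_one_right hB he

/-- The witness is POSITIVE on the boxes when `B > 0` (so it even carries the SIGN `BetaLowerH 0`, [Balaban1987RG1] Thm 2's unprinted `β > 0` in its
weakest form) and obeys the printed-type upper bound `BetaUpperH B`. [folklore] -/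
theorem betaLowerH_betaUpperH_expFamily {B : ℝ} (hB : 0 < B) (γ : ℝ) :
    BetaLowerH 0 γ (expFamily B) ∧ BetaUpperH B γ (expFamily B) :=
  ⟨fun _ _ _ => (mul_pos hB (Real.exp_pos _)).le,
    fun _ _ hv => (le_abs_self _).trans (abs_expFamily_le hB.le hv)⟩

/-- **MONOTONE ALONG THE SCALES**: `expFamily B (k+1) w ≤ expFamily B k (tail w)` on the boxes (`B ≥ 0`): `e^{−(k+1)g} ≤ e^{−kg}` for `g > 0`. [folklore] -/
theorem monotone_expFamily {B : ℝ} (hB : 0 ≤ B) (γ : ℝ) : MonotoneAlongScales γ (expFamily B) := by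
  intro k w hw
  have hg : 0 < w (Fin.last (k + 1)) := ((mem_box.mp hw) (Fin.last (k + 1))).1
  unfold expFamily
  rw [tail_last_eq]
  refine mul_le_mul_of_nonneg_left (Real.exp_le_exp.mpr ?_) hB
  have : (k : ℝ) * w (Fin.last (k + 1)) ≤ ((k + 1 : ℕ) : ℝ) * w (Fin.last (k + 1)) :=
    mul_le_mul_of_nonneg_right (by push_cast; linarith) hg.le
  linarith

/-- Hence one-sided NE4 for the witness with every `c ≥ 0`, `θ ≥ 0`. [folklore] -/
theorem scaleShiftUpper_expFamily {B c θ : ℝ} (hB : 0 ≤ B) (hc : 0 ≤ c) (hθ : 0 ≤ θ) (γ : ℝ) :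
    ScaleShiftUpper c θ γ (expFamily B) :=
  scaleShiftUpper_of_monotone (monotone_expFamily hB γ) hc hθ

/-- **THE WITNESS HAS RELATIVE REAL-ANALYTIC CHARTS, UNIFORMLY IN THE SCALE** (`B ≥ 0`, `ρ ≤ 1`): `LocalAnalyticRel B γ ρ (expFamily B)` — in the
last coupling the chart about `x > 0` is `z ↦ B·exp(−k z)` on the disc of radius `ρx ≤ x`, which lies in `Re z > 0` where `|exp(−kz)| ≤ 1` for EVERY
`k`; in the other couplings the section is constant.  So node U2's minimal regularity shape (census (R40)) does not rescue one-sidedness. [folklore] -/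
theorem localAnalyticRel_expFamily {B γ ρ : ℝ} (hB : 0 ≤ B) (hρ1 : ρ ≤ 1) : LocalAnalyticRel B γ ρ (expFamily B) := by
  intro k p hp i x hx
  have hx0 : 0 < x := hx.1
  by_cases hi : i = Fin.last k
  · subst hi
    have hre : ∀ z ∈ ball (x : ℂ) (ρ * x), 0 < z.re := fun z hz => by
      have h1 : ‖z - (x : ℂ)‖ < ρ * x := mem_ball_iff_norm.mp hz
      have h2 : |(z - (x : ℂ)).re| ≤ ‖z - (x : ℂ)‖ := Complex.abs_re_le_norm _
      have h3 : (z - (x : ℂ)).re = z.re - x := by simp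
      rw [h3] at h2
      have h4 : x - z.re < ρ * x := lt_of_le_of_lt ((neg_sub z.re x ▸ neg_le_abs (z.re - x))) (h2.trans_lt h1)
      have h5 : ρ * x ≤ 1 * x := mul_le_mul_of_nonneg_right hρ1 hx0.le
      linarith
    refine ⟨fun z => (B : ℂ) * Complex.exp (-((k : ℂ) * z)),
      fun z _ => (((differentiableAt_const _).mul differentiableAt_id).neg.cexp.const_mul _).differentiableWithinAt,
      fun z hz => ?_, fun t ht _ => ?_⟩
    · rw [norm_mul, Complex.norm_real, Real.norm_eq_abs, abs_of_nonneg hB, Complex.norm_exp]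
      have hre' : (-((k : ℂ) * z)).re = -((k : ℝ) * z.re) := by simp
      rw [hre']
      refine mul_le_of_le_one_right hB (Real.exp_le_one_iff.mpr ?_)
      exact neg_nonpos.mpr (mul_nonneg (Nat.cast_nonneg k) (hre z hz).le)
    · simp only [expFamily, Function.update_self]
      push_cast
      rfl
  · refine ⟨fun _ => (expFamily B k p : ℂ), differentiableOn_const _, fun z _ => ?_, fun t _ _ => ?_⟩
    · rw [Complex.norm_real, Real.norm_eq_abs]
      exact abs_expFamily_le hB hp
    · simp only [expFamily, Function.update_of_ne (Ne.symm hi)]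

/-- **THE HARMONIC LOWER BOUND**: for `k ≥ 1` with `1∕k ≤ γ`, the constant history `w ≡ 1∕k` (in the box) has
`|expFamily B (k+1) w − expFamily B k (tail w)| = B·e^{−1}(1 − e^{−1∕k}) ≥ B∕(2e·k)` (`B ≥ 0`).  So the sup-envelope of the two-sided scale
shift is at least harmonic — not summable, let alone geometric. [folklore] -/
theorem harmonic_lower_expFamily {B γ : ℝ} (hB : 0 ≤ B) {k : ℕ} (hk : 1 ≤ k) (hkγ : 1 / (k : ℝ) ≤ γ) :
    ∃ w : Fin (k + 2) → ℝ, w ∈ Box γ (k + 1) ∧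
      B / (2 * Real.exp 1 * k) ≤ |expFamily B (k + 1) w - expFamily B k (Fin.tail w)| := by
  have hk0 : (0 : ℝ) < k := by exact_mod_cast hk
  have hkinv : 0 < 1 / (k : ℝ) := by positivity
  refine ⟨fun _ => 1 / (k : ℝ), mem_box.mpr fun _ => ⟨hkinv, hkγ⟩, ?_⟩
  have e1 : expFamily B (k + 1) (fun _ => 1 / (k : ℝ)) = B * (Real.exp (-1) * Real.exp (-(1 / (k : ℝ)))) := by
    simp only [expFamily]
    rw [← Real.exp_add]
    congr 1
    push_cast
    field_simp
    ring
  have e2 : expFamily B k (Fin.tail fun _ => 1 / (k : ℝ)) = B * Real.exp (-1) := by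
    simp only [expFamily, Fin.tail]
    congr 1
    field_simp
  rw [e1, e2]
  -- elementary: `x∕2 ≤ 1 − e^{−x}` for `0 ≤ x ≤ 1` (from `1 + x ≤ e^x`), at `x = 1∕k`
  have hx : (1 / (k : ℝ)) / 2 ≤ 1 - Real.exp (-(1 / (k : ℝ))) := by
    have hx1 : 1 / (k : ℝ) ≤ 1 := (div_le_one hk0).mpr (by exact_mod_cast hk)
    have h1 : Real.exp (-(1 / (k : ℝ))) ≤ 1 / (1 + 1 / (k : ℝ)) := by
      rw [Real.exp_neg, one_div (1 + 1 / (k : ℝ))]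
      exact inv_anti₀ (by linarith) (by linarith [Real.add_one_le_exp (1 / (k : ℝ))])
    have h2 : 1 / (1 + 1 / (k : ℝ)) ≤ 1 - 1 / (k : ℝ) / 2 := by
      rw [div_le_iff₀ (by linarith)]
      nlinarith
    linarith
  have hval : B * (Real.exp (-1) * Real.exp (-(1 / (k : ℝ)))) - B * Real.exp (-1)
      = -(B * Real.exp (-1) * (1 - Real.exp (-(1 / (k : ℝ))))) := by ring
  rw [hval, abs_neg, abs_of_nonneg (by
    have : 0 ≤ 1 - Real.exp (-(1 / (k : ℝ))) := by linarith [hx, hkinv.le]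
    exact mul_nonneg (mul_nonneg hB (Real.exp_pos _).le) this)]
  have hem : Real.exp (-1) = (Real.exp 1)⁻¹ := Real.exp_neg 1
  rw [hem]
  have he0 : 0 < Real.exp 1 := Real.exp_pos 1
  calc B / (2 * Real.exp 1 * k) = B * (Real.exp 1)⁻¹ * ((1 / (k : ℝ)) / 2) := by
        field_simp
    _ ≤ B * (Real.exp 1)⁻¹ * (1 - Real.exp (-(1 / (k : ℝ)))) :=
        mul_le_mul_of_nonneg_left hx (mul_nonneg hB (inv_nonneg.mpr he0.le))

/-- **NO TWO-SIDED RATE**: `ScaleShiftRate c θ γ (expFamily B)` FAILS for every `c` and every `0 ≤ θ < 1` (`B > 0`, `γ > 0`): the harmonic lower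
bound `B∕(2e·k) ≤ cθ^k` for all large `k` contradicts `k·θ^k → 0`.  With §1–§2 and `localAnalyticRel_expFamily`: {one-sided NE4 (even `c = 0`),
`LocalAnalyticRel B γ ρ` for all `ρ ≤ 1`, the uniform bound} ⊬ NE4 — one-sidedness ∕ monotone cutoff-dependence is NOT a door at node U2. [folklore] -/
theorem not_scaleShiftRate_expFamily {B γ θ : ℝ} (hB : 0 < B) (hγ : 0 < γ) (hθ0 : 0 ≤ θ) (hθ1 : θ < 1) (c : ℝ) :
    ¬ ScaleShiftRate c θ γ (expFamily B) := by
  intro h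
  have he0 : 0 < Real.exp 1 := Real.exp_pos 1
  -- for all large k: B/(2e) ≤ |c|·(k θ^k)
  have key : ∀ k : ℕ, 1 ≤ k → 1 / (k : ℝ) ≤ γ → B / (2 * Real.exp 1) ≤ |c| * ((k : ℝ) * θ ^ k) := by
    intro k hk hkγ
    have hk0 : (0 : ℝ) < k := by exact_mod_cast hk
    obtain ⟨w, hw, hlow⟩ := harmonic_lower_expFamily (γ := γ) hB.le hk hkγ
    have hup : |expFamily B (k + 1) w - expFamily B k (Fin.tail w)| ≤ c * θ ^ k := h k w hw
    have h1 : B / (2 * Real.exp 1 * k) ≤ c * θ ^ k := hlow.trans hup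
    have h2 : c * θ ^ k ≤ |c| * θ ^ k := mul_le_mul_of_nonneg_right (le_abs_self c) (pow_nonneg hθ0 k)
    have h3 : B / (2 * Real.exp 1 * k) * k = B / (2 * Real.exp 1) := by field_simp
    calc B / (2 * Real.exp 1) = B / (2 * Real.exp 1 * k) * k := h3.symm
      _ ≤ |c| * θ ^ k * k := mul_le_mul_of_nonneg_right (h1.trans h2) hk0.le
      _ = |c| * ((k : ℝ) * θ ^ k) := by ring
  have hlim : Tendsto (fun k : ℕ => |c| * ((k : ℝ) * θ ^ k)) atTop (𝓝 (|c| * 0)) :=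
    (tendsto_self_mul_const_pow_of_lt_one hθ0 hθ1).const_mul |c|
  rw [mul_zero] at hlim
  have hev : ∀ᶠ k : ℕ in atTop, |c| * ((k : ℝ) * θ ^ k) < B / (2 * Real.exp 1) :=
    hlim.eventually_lt_const (by positivity)
  have hkγ : ∀ᶠ k : ℕ in atTop, 1 / (k : ℝ) ≤ γ := by
    refine (eventually_ge_atTop ⌈1 / γ⌉₊).mono fun k hk => ?_
    have hk' : 1 / γ ≤ (k : ℝ) := (Nat.le_ceil _).trans (by exact_mod_cast hk)
    have hk0 : (0 : ℝ) < k := lt_of_lt_of_le (by positivity) hk'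
    rw [div_le_iff₀ hk0]
    calc (1 : ℝ) = 1 / γ * γ := by field_simp
      _ ≤ k * γ := mul_le_mul_of_nonneg_right hk' hγ.le
      _ = γ * k := mul_comm _ _
  obtain ⟨k, hk1, hk2, hk3⟩ := ((eventually_ge_atTop 1).and (hkγ.and hev)).exists
  exact absurd (key k hk1 hk2) (not_le.mpr hk3)

/-- **SUMMARY (R41)**: the witness meets one-sided NE4 with `c = 0` at every rate, the uniform bound `B`, and node U2's relative-chart shape at
every `ρ ≤ 1` — and violates NE4 at every `(c, θ)` with `0 ≤ θ < 1`. [folklore] -/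
theorem oneSided_not_a_door {B γ θ ρ : ℝ} (hB : 0 < B) (hγ : 0 < γ) (hθ0 : 0 ≤ θ) (hθ1 : θ < 1) (hρ1 : ρ ≤ 1) (c : ℝ) :
    MonotoneAlongScales γ (expFamily B) ∧ ScaleShiftUpper 0 θ γ (expFamily B) ∧
      (∀ k (v : Fin (k + 1) → ℝ), v ∈ Box γ k → |expFamily B k v| ≤ B) ∧ LocalAnalyticRel B γ ρ (expFamily B) ∧
      ¬ ScaleShiftRate c θ γ (expFamily B) :=
  ⟨monotone_expFamily hB.le γ, scaleShiftUpper_expFamily hB.le le_rfl hθ0 γ, fun _ _ hv => abs_expFamily_le hB.le hv,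
    localAnalyticRel_expFamily hB.le hρ1, not_scaleShiftRate_expFamily hB hγ hθ0 hθ1 c⟩

/-! ## §4 (v1.1 append, generation 8) What survives of (R17) under one-sided control: the limit functional AND its fading memory — only the RATE dies

Pure addition; the v1 declarations above are byte-unchanged.  `T4BetaStationary.memoryProfile_betaInf` used the two-sided NE4 only to make
`betaInf` a limit; with `tendsto_betaInf_of_upper` the same argument runs under ONE-SIDED NE4 + the uniform bound. -/

/-- **THE LIMIT FUNCTIONAL KEEPS ITS GEOMETRIC MEMORY UNDER ONE-SIDED CONTROL**: one-sided NE4 (`c ≥ 0`, `0 ≤ θ < 1`), the uniform bound `|β| ≤ B`,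
history moduli `HistLipschitz Λ γ β` with `FadingMemory Cm θm Λ` (`0 ≤ θm < 1`) ⟹ `T4BetaStationary.MemoryProfile Cm θm γ (betaInf β)`:
`|β_∞(h) − β_∞(h′)| ≤ Cm·Σ′_j θm^j |h j − h′ j|`.  So of (R17)'s continuum β-functional everything survives the one-sided weakening EXCEPT the rate of
approach `|β k (revHist h k) − β_∞(h)| ≤ cθ^k∕(1−θ)` — which is exactly what node U2 consumes. [folklore] -/
theorem memoryProfile_betaInf_of_upper {c θ γ B Cm θm : ℝ} {Λ : ℕ → ℕ → ℝ} {β : HBeta} (hU : ScaleShiftUpper c θ γ β)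
    (hB : ∀ k (v : Fin (k + 1) → ℝ), v ∈ Box γ k → |β k v| ≤ B) (hc : 0 ≤ c) (hθ0 : 0 ≤ θ) (hθ1 : θ < 1)
    (hL : HistLipschitz Λ γ β) (hF : FadingMemory Cm θm Λ) (hθm0 : 0 ≤ θm) (hθm1 : θm < 1) :
    MemoryProfile Cm θm γ (betaInf β) := by
  intro h h' hh hh'
  have hCm : 0 ≤ Cm := constant_nonneg_of_fadingMemory hF
  have ht := ((tendsto_betaInf_of_upper hU hB hc hθ0 hθ1 hh).sub (tendsto_betaInf_of_upper hU hB hc hθ0 hθ1 hh')).abs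
  refine le_of_tendsto' ht fun k => ?_
  calc |β k (revHist h k) - β k (revHist h' k)|
      ≤ ∑ j ∈ Finset.range (k + 1), Cm * θm ^ j * |h j - h' j| := abs_beta_revHist_sub_le_sum hL hF hh hh' k
    _ = Cm * ∑ j ∈ Finset.range (k + 1), θm ^ j * |h j - h' j| := by
        rw [Finset.mul_sum]
        exact Finset.sum_congr rfl fun j _ => by ring
    _ ≤ Cm * ∑' j, θm ^ j * |h j - h' j| :=
        mul_le_mul_of_nonneg_left (sum_profile_le_tsum hθm0 hθm1 hh hh' (k + 1)) hCm

/-- **DEPTH FORM**: under the same one-sided hypotheses, two box-valued histories agreeing at all ages `j < N` have continuum β-values within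
`Cm·γ·θm^N∕(1−θm)`. [folklore] -/
theorem abs_betaInf_sub_le_of_agree_of_upper {c θ γ B Cm θm : ℝ} {Λ : ℕ → ℕ → ℝ} {β : HBeta} (hU : ScaleShiftUpper c θ γ β)
    (hB : ∀ k (v : Fin (k + 1) → ℝ), v ∈ Box γ k → |β k v| ≤ B) (hc : 0 ≤ c) (hθ0 : 0 ≤ θ) (hθ1 : θ < 1)
    (hL : HistLipschitz Λ γ β) (hF : FadingMemory Cm θm Λ) (hθm0 : 0 ≤ θm) (hθm1 : θm < 1) {h h' : ℕ → ℝ}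
    (hh : SeqBox γ h) (hh' : SeqBox γ h') {N : ℕ} (hagree : ∀ j, j < N → h j = h' j) :
    |betaInf β h - betaInf β h'| ≤ Cm * (γ * θm ^ N / (1 - θm)) := by
  have hCm : 0 ≤ Cm := constant_nonneg_of_fadingMemory hF
  have ht := ((tendsto_betaInf_of_upper hU hB hc hθ0 hθ1 hh).sub (tendsto_betaInf_of_upper hU hB hc hθ0 hθ1 hh')).abs
  refine le_of_tendsto' ht fun k => ?_
  calc |β k (revHist h k) - β k (revHist h' k)|
      ≤ ∑ j ∈ Finset.range (k + 1), Cm * θm ^ j * |h j - h' j| := abs_beta_revHist_sub_le_sum hL hF hh hh' k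
    _ = Cm * ∑ j ∈ Finset.range (k + 1), θm ^ j * |h j - h' j| := by
        rw [Finset.mul_sum]
        exact Finset.sum_congr rfl fun j _ => by ring
    _ ≤ Cm * (γ * θm ^ N / (1 - θm)) :=
        mul_le_mul_of_nonneg_left (sum_profile_le_of_agree hθm0 hθm1 hh hh' hagree (k + 1)) hCm

/-! ## §5 (v1.2 append, generation 8) The witness' continuum β-functional is IDENTICALLY ZERO — the tamest possible limit, and still no rate -/

/-- **`betaInf (expFamily B) h = 0` for every history with `h 0 > 0`**: along `revHist h k` the witness reads `B·e^{−k·h 0} → 0`.  So the one-sided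
witness converges MONOTONICALLY to the SMOOTHEST conceivable continuum β-functional (a constant), with bounded variation and every node-U2 companion —
and the approach still has no geometric (indeed no summable) rate: the rate in NE4 is information about the CUTOFF dependence that no property of the
limit and no qualitative mode of convergence encodes. [folklore] -/
theorem betaInf_expFamily (B : ℝ) {h : ℕ → ℝ} (hh0 : 0 < h 0) : betaInf (expFamily B) h = 0 := by
  have hlim : Tendsto (fun k : ℕ => expFamily B k (revHist h k)) atTop (𝓝 0) := by
    have h1 : Tendsto (fun k : ℕ => (k : ℝ) * h 0) atTop atTop :=
      tendsto_natCast_atTop_atTop.atTop_mul_const hh0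
    have h2 : Tendsto (fun k : ℕ => Real.exp (-((k : ℝ) * h 0))) atTop (𝓝 0) :=
      Real.tendsto_exp_neg_atTop_nhds_zero.comp h1
    have h3 := h2.const_mul B
    rw [mul_zero] at h3
    refine h3.congr fun k => ?_
    simp only [expFamily, revHist_last]
  rw [betaInf, hlim.limUnder_eq]

end Summit.QuantumFields.BalabanUV.T4Continuum.Spine.NE4

end
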